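import Summits.AnomalousDissipation.AnomalousDissipation.Theorems.SawtoothPulseCascadeApproxEnvelopeBox

/-!
# The `L²` envelope of the forced linearised response at a SYMBOLIC corner rounding `δ₀`
(route `AnomalousDissipation/SawtoothPulseCascade`; helper for the crux K1loc = stmt-AnomalousDissipation-19491,
δ₀-generalisation of the pointwise closure — ROUND-18 §D.2 of the K1loc arbiter)

The landed `L²` envelope `ApproxResponse.responseL2Envelope` (S1 of the line `linear-response-lip`) is stated at the
box point `⟨γ, 1/4, 2, 1, ρN⟩`.  The K1loc chain of record proves `K1Localised ⟨γ, δ₀, 2, 1, 2⟩ (γ²−3)` at a SMALL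
corner rounding `δ₀` (shape P of the arbiter's restatement), so the closure `K1loc ∧ K2 → Target` must be re-run with
`δ₀` symbolic.  This file is the first layer: the same theorem at `P = ⟨γ, δ₀, 2, 1, ρN⟩`, `0 < δ₀`, where the only
change is the box arithmetic `N_j/δ_j = (1/δ₀)(2ρN)^j` (the prefactor `4 = 1/(1/4)` becomes `1/δ₀`) and the budget
threshold `ν_b(A, δ₀)` making `16π²νN_j²tHalf_j ≤ δ_j² = δ₀²/4^j` hold up to the horizon phase.

* §1 box arithmetic at `⟨γ, δ₀, 2, 1, ρN⟩`; §2 the budget threshold; §3 the envelope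
  `√∫‖L(t)‖² ≤ K ν (j+1) M₂^{j+1}`, `M₂ = max (3e^{σ⋆γ}) (2ρN) < γ² − 3`, `K = (24√π + 6√(2π)) γ / δ₀`.
-/

set_option linter.dupNamespace false

noncomputable section

namespace Summit.AnomalousDissipation.AnomalousDissipation.Theorems.SawtoothPulseCascade.ApproxResponse

open Set MeasureTheory UnitAddTorus
open scoped ContDiff InnerProductSpace
open Literature.Analysis Literature.Analysis.FunctionSpaces Literature.Analysis.FluidPDE
open Literature.Analysis.FluidPDE.SawtoothCascade
open Literature.Analysis.FluidPDE.SawtoothCascade.CascadeParams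
open Summit.AnomalousDissipation.AnomalousDissipation.Theorems.SawtoothPulseCascade.K2Classical

/-! ## §1 Box arithmetic at `P = ⟨γ, δ₀, 2, 1, ρN⟩` -/

/-- `N_j = ρN^j` at `⟨γ, δ₀, 2, 1, ρN⟩`. -/
theorem pbox_N (γ δ₀ : ℝ) (ρN j : ℕ) : ((⟨γ, δ₀, 2, 1, ρN⟩ : CascadeParams).N j : ℝ) = (ρN : ℝ) ^ j := by
  simp [CascadeParams.N]

/-- `δ_j = δ₀/2^j` at `⟨γ, δ₀, 2, 1, ρN⟩`. -/
theorem pbox_δ (γ δ₀ : ℝ) (ρN j : ℕ) : (⟨γ, δ₀, 2, 1, ρN⟩ : CascadeParams).δ j = δ₀ / (2 : ℝ) ^ j := by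
  simp [CascadeParams.δ]

/-- `N_j ≠ 0` at `⟨γ, δ₀, 2, 1, ρN⟩` (`ρN ≠ 0`). -/
theorem pbox_N_ne_zero (γ δ₀ : ℝ) {ρN : ℕ} (hρ : ρN ≠ 0) (j : ℕ) :
    (⟨γ, δ₀, 2, 1, ρN⟩ : CascadeParams).N j ≠ 0 := by
  simp [CascadeParams.N, hρ]

/-- `N_j/δ_j = (1/δ₀)(2ρN)^j` at `⟨γ, δ₀, 2, 1, ρN⟩` (`δ₀ ≠ 0`). -/
theorem pbox_N_div_δ (γ : ℝ) {δ₀ : ℝ} (hδ₀ : δ₀ ≠ 0) (ρN j : ℕ) :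
    ((⟨γ, δ₀, 2, 1, ρN⟩ : CascadeParams).N j : ℝ) / (⟨γ, δ₀, 2, 1, ρN⟩ : CascadeParams).δ j =
      (1 / δ₀) * (2 * (ρN : ℝ)) ^ j := by
  rw [pbox_N, pbox_δ, mul_pow]
  have h2 : (2 : ℝ) ^ j ≠ 0 := pow_ne_zero _ two_ne_zero
  field_simp

/-- **Geometric bound of the phase envelope at `⟨γ, δ₀, 2, 1, ρN⟩`.**  With `C₁ ≥ 0`, `M = max C₁ (2ρN)` (`ρN ≥ 1`),
`ν, γ ≥ 0`, `δ₀ > 0`: the right-hand side of `response_envelope_of_budget` on slot `k` is at most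
`((24√π + 6√(2π)) γ / δ₀) ν (k/2 + 1) M^{k/2+1}`. -/
theorem pbox_sum_le (γ : ℝ) (hγ : 0 ≤ γ) {δ₀ : ℝ} (hδ₀ : 0 < δ₀) {ρN : ℕ} (hρ : 1 ≤ ρN) {ν C₁ : ℝ} (hν : 0 ≤ ν)
    (hC₁ : 0 ≤ C₁) (k : ℕ) :
    ∑ i ∈ Finset.range k, C₁ ^ (k / 2 + 1 - i / 2) *
        (12 * Real.sqrt Real.pi * ν * γ * ((⟨γ, δ₀, 2, 1, ρN⟩ : CascadeParams).N (i / 2)) /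
          (⟨γ, δ₀, 2, 1, ρN⟩ : CascadeParams).δ (i / 2)) +
      6 * Real.sqrt (2 * Real.pi) * ν * ((⟨γ, δ₀, 2, 1, ρN⟩ : CascadeParams).N (k / 2)) * γ /
        (⟨γ, δ₀, 2, 1, ρN⟩ : CascadeParams).δ (k / 2) ≤
      (24 * Real.sqrt Real.pi + 6 * Real.sqrt (2 * Real.pi)) * γ / δ₀ * ν * ((k / 2 : ℕ) + 1) *
        (max C₁ (2 * ρN)) ^ (k / 2 + 1) := by
  set M : ℝ := max C₁ (2 * ρN) with hM
  have hδ₀' : δ₀ ≠ 0 := hδ₀.ne'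
  have hρ' : (1 : ℝ) ≤ ρN := by exact_mod_cast hρ
  have hM1 : 1 ≤ M := le_max_of_le_right (by linarith)
  have hM0 : 0 ≤ M := le_trans zero_le_one hM1
  have hC₁M : C₁ ≤ M := le_max_left _ _
  have h2ρM : 2 * (ρN : ℝ) ≤ M := le_max_right _ _
  have hsπ : 0 ≤ Real.sqrt Real.pi := Real.sqrt_nonneg _
  have hs2π : 0 ≤ Real.sqrt (2 * Real.pi) := Real.sqrt_nonneg _
  have hiδ : 0 ≤ 1 / δ₀ := by positivity
  -- each summand ≤ (12 √π ν γ / δ₀) M^{k/2+1}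
  have hterm : ∀ i ∈ Finset.range k, C₁ ^ (k / 2 + 1 - i / 2) *
      (12 * Real.sqrt Real.pi * ν * γ * ((⟨γ, δ₀, 2, 1, ρN⟩ : CascadeParams).N (i / 2)) /
        (⟨γ, δ₀, 2, 1, ρN⟩ : CascadeParams).δ (i / 2)) ≤
        12 * Real.sqrt Real.pi * ν * γ * (1 / δ₀) * M ^ (k / 2 + 1) := by
    intro i hi
    have hexp : k / 2 + 1 - i / 2 + i / 2 = k / 2 + 1 := by
      have hi' : i < k := Finset.mem_range.1 hi
      omega
    rw [mul_div_assoc, pbox_N_div_δ γ hδ₀' ρN]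
    calc C₁ ^ (k / 2 + 1 - i / 2) * (12 * Real.sqrt Real.pi * ν * γ * ((1 / δ₀) * (2 * (ρN : ℝ)) ^ (i / 2)))
        = 12 * Real.sqrt Real.pi * ν * γ * (1 / δ₀) * (C₁ ^ (k / 2 + 1 - i / 2) * (2 * (ρN : ℝ)) ^ (i / 2)) := by
          ring
      _ ≤ 12 * Real.sqrt Real.pi * ν * γ * (1 / δ₀) * (M ^ (k / 2 + 1 - i / 2) * M ^ (i / 2)) := by
          refine mul_le_mul_of_nonneg_left ?_ (by positivity)
          exact mul_le_mul (pow_le_pow_left₀ hC₁ hC₁M _) (pow_le_pow_left₀ (by positivity) h2ρM _)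
            (by positivity) (pow_nonneg hM0 _)
      _ = 12 * Real.sqrt Real.pi * ν * γ * (1 / δ₀) * M ^ (k / 2 + 1) := by rw [← pow_add, hexp]
  have hsum : ∑ i ∈ Finset.range k, C₁ ^ (k / 2 + 1 - i / 2) *
      (12 * Real.sqrt Real.pi * ν * γ * ((⟨γ, δ₀, 2, 1, ρN⟩ : CascadeParams).N (i / 2)) /
        (⟨γ, δ₀, 2, 1, ρN⟩ : CascadeParams).δ (i / 2)) ≤
        k * (12 * Real.sqrt Real.pi * ν * γ * (1 / δ₀) * M ^ (k / 2 + 1)) := by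
    have h := Finset.sum_le_sum hterm
    rwa [Finset.sum_const, Finset.card_range, nsmul_eq_mul] at h
  have hlast : 6 * Real.sqrt (2 * Real.pi) * ν * ((⟨γ, δ₀, 2, 1, ρN⟩ : CascadeParams).N (k / 2)) * γ /
      (⟨γ, δ₀, 2, 1, ρN⟩ : CascadeParams).δ (k / 2) ≤
        6 * Real.sqrt (2 * Real.pi) * ν * γ * (1 / δ₀) * M ^ (k / 2 + 1) := by
    have h1 : 6 * Real.sqrt (2 * Real.pi) * ν * ((⟨γ, δ₀, 2, 1, ρN⟩ : CascadeParams).N (k / 2)) * γ /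
        (⟨γ, δ₀, 2, 1, ρN⟩ : CascadeParams).δ (k / 2) =
        6 * Real.sqrt (2 * Real.pi) * ν * γ * (((⟨γ, δ₀, 2, 1, ρN⟩ : CascadeParams).N (k / 2) : ℝ) /
          (⟨γ, δ₀, 2, 1, ρN⟩ : CascadeParams).δ (k / 2)) := by ring
    rw [h1, pbox_N_div_δ γ hδ₀' ρN]
    have hp : (2 * (ρN : ℝ)) ^ (k / 2) ≤ M ^ (k / 2 + 1) :=
      (pow_le_pow_left₀ (by positivity) h2ρM _).trans (pow_le_pow_right₀ hM1 (Nat.le_succ _))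
    calc 6 * Real.sqrt (2 * Real.pi) * ν * γ * ((1 / δ₀) * (2 * (ρN : ℝ)) ^ (k / 2))
        = 6 * Real.sqrt (2 * Real.pi) * ν * γ * (1 / δ₀) * (2 * (ρN : ℝ)) ^ (k / 2) := by ring
      _ ≤ 6 * Real.sqrt (2 * Real.pi) * ν * γ * (1 / δ₀) * M ^ (k / 2 + 1) :=
          mul_le_mul_of_nonneg_left hp (by positivity)
  have hk2 : (k : ℝ) ≤ 2 * (((k / 2 : ℕ) : ℝ) + 1) := by
    have : k ≤ 2 * (k / 2 + 1) := by omega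
    exact_mod_cast this
  have hj1 : (1 : ℝ) ≤ ((k / 2 : ℕ) : ℝ) + 1 := by
    have : (0 : ℝ) ≤ ((k / 2 : ℕ) : ℝ) := Nat.cast_nonneg _
    linarith
  have hX : 0 ≤ 12 * Real.sqrt Real.pi * ν * γ * (1 / δ₀) * M ^ (k / 2 + 1) := by positivity
  have hY : 0 ≤ 6 * Real.sqrt (2 * Real.pi) * ν * γ * (1 / δ₀) * M ^ (k / 2 + 1) := by positivity
  calc _ ≤ k * (12 * Real.sqrt Real.pi * ν * γ * (1 / δ₀) * M ^ (k / 2 + 1)) +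
        6 * Real.sqrt (2 * Real.pi) * ν * γ * (1 / δ₀) * M ^ (k / 2 + 1) := add_le_add hsum hlast
    _ ≤ 2 * (((k / 2 : ℕ) : ℝ) + 1) * (12 * Real.sqrt Real.pi * ν * γ * (1 / δ₀) * M ^ (k / 2 + 1)) +
          (((k / 2 : ℕ) : ℝ) + 1) * (6 * Real.sqrt (2 * Real.pi) * ν * γ * (1 / δ₀) * M ^ (k / 2 + 1)) := by
        nlinarith
    _ = (24 * Real.sqrt Real.pi + 6 * Real.sqrt (2 * Real.pi)) * γ / δ₀ * ν * (((k / 2 : ℕ) : ℝ) + 1) *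
          M ^ (k / 2 + 1) := by
        field_simp
        ring


/-! ## §2 The budget threshold `ν_b(A, δ₀)` -/

/-- **The budget threshold at corner rounding `δ₀`.**  For `(γ, ρN)` in the box, `δ₀ > 0` and every lag `A` there is
`ν_b > 0` such that for all `ν ∈ (0, ν_b]` and all phases `j ≤ J_{γ²−3}(ν) + A` the (halved) analyticity budget
`16π² ν N_j² tHalf_j ≤ δ_j²` holds at `P = ⟨γ, δ₀, 2, 1, ρN⟩` (`δ_j = δ₀/2^j`). -/
theorem pbudget_threshold {γ : ℝ} (hγ : γ ∈ Icc (5 : ℝ) 8) {δ₀ : ℝ} (hδ₀ : 0 < δ₀) {ρN : ℕ}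
    (hρN : ρN ∈ Finset.Icc 2 7) (A : ℕ) :
    ∃ νb : ℝ, 0 < νb ∧ ∀ ν ∈ Ioc 0 νb, ∀ j ≤ Jrate (γ ^ 2 - 3) ν + A,
      16 * Real.pi ^ 2 * ν * (((⟨γ, δ₀, 2, 1, ρN⟩ : CascadeParams).N j : ℕ) : ℝ) ^ 2 * tHalf j ≤
        (⟨γ, δ₀, 2, 1, ρN⟩ : CascadeParams).δ j ^ 2 := by
  obtain ⟨hρ2, hρ7⟩ := Finset.mem_Icc.1 hρN
  have hρ2' : (2 : ℝ) ≤ ρN := by exact_mod_cast hρ2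
  set r : ℝ := γ ^ 2 - 3 with hr
  set q : ℝ := 4 * (ρN : ℝ) ^ 2 with hq
  have hr22 : 22 ≤ r := by rw [hr]; nlinarith [hγ.1]
  have hr1 : 1 < r := by linarith
  have hq1 : 1 ≤ q := by rw [hq]; nlinarith
  have hq0 : 0 < q := by linarith
  have hρ7' : (ρN : ℝ) ≤ 7 := by exact_mod_cast hρ7
  have hqr : q < r ^ 2 := by rw [hq]; nlinarith
  set θ : ℝ := Real.log q / (2 * Real.log r) with hθ
  have hlogr : 0 < Real.log r := Real.log_pos hr1
  have hθ1 : θ < 1 := by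
    rw [hθ, div_lt_one (by positivity)]
    have h2 : 2 * Real.log r = Real.log (r ^ 2) := by rw [Real.log_pow]; norm_num
    rw [h2]
    exact Real.log_lt_log hq0 hqr
  have hθ0 : 0 ≤ θ := div_nonneg (Real.log_nonneg hq1) (by positivity)
  have h1θ : 0 < 1 - θ := by linarith
  set c : ℝ := δ₀ ^ 2 / (1300 * q ^ (A + 1)) with hc
  have hc0 : 0 < c := by rw [hc]; positivity
  set νb : ℝ := min 1 (c ^ (1 / (1 - θ))) with hνb
  have hνb0 : 0 < νb := lt_min one_pos (Real.rpow_pos_of_pos hc0 _)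
  refine ⟨νb, hνb0, fun ν hν j hj => ?_⟩
  have hν0 : 0 < ν := hν.1
  have hν1 : ν ≤ 1 := hν.2.trans (min_le_left _ _)
  have hνc : ν ≤ c ^ (1 / (1 - θ)) := hν.2.trans (min_le_right _ _)
  -- Step 1: `ν q^j ≤ δ₀²/1300`
  have hA : ν * q ^ j ≤ δ₀ ^ 2 / 1300 := by
    have hj' : q ^ j ≤ q ^ A * q ^ Jrate r ν := by
      rw [← pow_add]; exact pow_le_pow_right₀ hq1 (by omega)
    have hpow : ν ^ (1 - θ) ≤ c := by
      calc ν ^ (1 - θ) ≤ (c ^ (1 / (1 - θ))) ^ (1 - θ) := Real.rpow_le_rpow hν0.le hνc h1θ.le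
        _ = c := by rw [one_div, Real.rpow_inv_rpow hc0.le h1θ.ne']
    calc ν * q ^ j ≤ ν * (q ^ A * q ^ Jrate r ν) := mul_le_mul_of_nonneg_left hj' hν0.le
      _ = q ^ A * (ν * q ^ Jrate r ν) := by ring
      _ ≤ q ^ A * (q * ν ^ (1 - θ)) :=
          mul_le_mul_of_nonneg_left (mul_pow_Jrate_le hq1 hr1 hν0 hν1) (by positivity)
      _ ≤ q ^ A * (q * c) := by gcongr
      _ = δ₀ ^ 2 / 1300 := by rw [hc]; field_simp; ring
  -- Step 2: unfold the budget at the parameter point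
  rw [pbox_N, pbox_δ]
  have hπ3 : 3 < Real.pi := Real.pi_gt_three
  have hπ4 : 0 < Real.pi ^ 4 := by positivity
  have hth := tHalf_le j
  have hρN2j : ((ρN : ℝ) ^ j) ^ 2 = ((ρN : ℝ) ^ 2) ^ j := by ring
  have hqj : q ^ j = 4 ^ j * ((ρN : ℝ) ^ 2) ^ j := by rw [hq, mul_pow]
  have h4j : (0 : ℝ) < 4 ^ j := by positivity
  have h2j : (δ₀ / (2 : ℝ) ^ j) ^ 2 = δ₀ ^ 2 / 4 ^ j := by
    rw [div_pow, ← pow_mul, show (2 : ℝ) ^ (j * 2) = 4 ^ j by rw [mul_comm, pow_mul]; norm_num]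
  rw [h2j, hρN2j]
  have hνρ : ν * ((ρN : ℝ) ^ 2) ^ j ≤ δ₀ ^ 2 / 1300 / 4 ^ j := by
    have : ν * ((ρN : ℝ) ^ 2) ^ j = ν * q ^ j / 4 ^ j := by rw [hqj]; field_simp
    rw [this]
    exact div_le_div_of_nonneg_right hA h4j.le
  have hπ2 : 9 < Real.pi ^ 2 := by nlinarith
  have hδ2 : 0 < δ₀ ^ 2 := by positivity
  calc 16 * Real.pi ^ 2 * ν * ((ρN : ℝ) ^ 2) ^ j * tHalf j
      ≤ 16 * Real.pi ^ 2 * ν * ((ρN : ℝ) ^ 2) ^ j * (45 / Real.pi ^ 4) :=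
        mul_le_mul_of_nonneg_left hth (by positivity)
    _ = 720 * (ν * ((ρN : ℝ) ^ 2) ^ j) / Real.pi ^ 2 := by field_simp; ring
    _ ≤ 720 * (δ₀ ^ 2 / 1300 / 4 ^ j) / Real.pi ^ 2 := by gcongr
    _ ≤ δ₀ ^ 2 / 4 ^ j := by
        rw [div_le_div_iff₀ (by positivity) (by positivity)]
        have e1 : 720 * (δ₀ ^ 2 / 1300 / (4 : ℝ) ^ j) * 4 ^ j = 720 / 1300 * δ₀ ^ 2 := by
          field_simp
        rw [e1]
        nlinarith [hπ2, hδ2]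


/-! ## §3 The envelope at `⟨γ, δ₀, 2, 1, ρN⟩` -/

/-- **The geometric `L²` envelope of the forced linearised response at corner rounding `δ₀`** (the landed
`responseL2Envelope` with `1/4 ↦ δ₀`, `0 < δ₀`): assuming the per-phase cap `K2PhaseGrowthClassical ⟨γ,δ₀,2,1,ρN⟩ 3`,
with `M₂ = max (3e^{σ⋆γ}) (2ρN) < γ² − 3` and `K = (24√π + 6√(2π)) γ / δ₀`, for every lag `A` there is `ν₀ > 0` such
that for all `ν ∈ (0, ν₀]`, every window `[0, T']` beyond the horizon and every classical solution `(L, q)` of the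
heat-lag-forced linearised equations from zero, `√∫‖L(t)‖² ≤ K ν (j+1) M₂^{j+1}` for `t ≤ horizon` in phase `j`. -/
theorem responseL2EnvelopeP {γ : ℝ} (hγ : γ ∈ Icc (5 : ℝ) 8) {δ₀ : ℝ} (hδ₀ : 0 < δ₀) {ρN : ℕ}
    (hρN : ρN ∈ Finset.Icc 2 7) (hK2 : K2PhaseGrowthClassical ⟨γ, δ₀, 2, 1, ρN⟩ 3) :
    ∃ M₂ K : ℝ, 0 ≤ M₂ ∧ M₂ < γ ^ 2 - 3 ∧ 0 ≤ K ∧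
      ∀ A : ℕ, ∃ ν₀ : ℝ, 0 < ν₀ ∧ ∀ ν ∈ Ioc 0 ν₀, ∀ T' : ℝ,
        DriftFree.horizon (γ ^ 2 - 3) ν A < T' → T' < 1 →
        ∀ (L : ℝ → UnitAddTorus (Fin 2) → EuclideanSpace ℝ (Fin 2)) (q : ℝ → UnitAddTorus (Fin 2) → ℝ),
          Torus.IsSmoothSpaceTimeOn (Icc 0 T') L → Torus.IsSmoothSpaceTimeOn (Icc 0 T') q →
          (∀ t ∈ Icc 0 T', Torus.IsDivFree (L t)) → L 0 = 0 →
          (∀ t ∈ Icc 0 T', ∀ x, Torus.timeDerivWithin (Icc 0 T') L t x +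
            Torus.convect ((⟨γ, δ₀, 2, 1, ρN⟩ : CascadeParams).field t) (L t) x +
            Torus.convect (L t) ((⟨γ, δ₀, 2, 1, ρN⟩ : CascadeParams).field t) x =
              ν • Torus.laplacian (L t) x - Torus.gradient (q t) x +
                ν • Torus.laplacian ((⟨γ, δ₀, 2, 1, ρN⟩ : CascadeParams).field t) x) →
          ∀ j : ℕ, ∀ t ∈ Icc 0 (DriftFree.horizon (γ ^ 2 - 3) ν A),
            t ∈ Icc (CascadeParams.tStart j) (CascadeParams.tStart (j + 1)) →
            Real.sqrt (Torus.vectorL2Sq (L t)) ≤ K * ν * ((j : ℝ) + 1) * M₂ ^ (j + 1) := by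
  set P : CascadeParams := ⟨γ, δ₀, 2, 1, ρN⟩ with hP
  obtain ⟨hρ2, hρ7⟩ := Finset.mem_Icc.1 hρN
  have hρ1 : 1 ≤ ρN := le_trans (by norm_num) hρ2
  have hγ0 : 0 ≤ γ := le_trans (by norm_num) hγ.1
  set M : ℝ := max (3 * Real.exp (sawSigmaStar * γ)) (2 * ρN) with hM
  set K : ℝ := (24 * Real.sqrt Real.pi + 6 * Real.sqrt (2 * Real.pi)) * γ / δ₀ with hK
  have hM1 : 1 ≤ M := le_max_of_le_right (by
    have : (2 : ℝ) ≤ ρN := by exact_mod_cast hρ2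
    linarith)
  have hM0 : 0 ≤ M := zero_le_one.trans hM1
  have hMlt : M < γ ^ 2 - 3 := by
    refine max_lt (DriftFree.driftFreeWindow58 γ hγ) ?_
    have : (ρN : ℝ) ≤ 7 := by exact_mod_cast hρ7
    nlinarith [hγ.1]
  have hK0 : 0 ≤ K := by rw [hK]; positivity
  refine ⟨M, K, hM0, hMlt, hK0, fun A => ?_⟩
  obtain ⟨ν₁, hν₁, hK2ν⟩ := hK2
  obtain ⟨νb, hνb, hbud⟩ := pbudget_threshold hγ hδ₀ hρN A
  refine ⟨min ν₁ νb, lt_min hν₁ hνb, fun ν hν T' hT hT'1 L q hL hq hLdiv hL0 hlin j t ht htj => ?_⟩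
  have hν0 : 0 < ν := hν.1
  have hν₁' : ν ∈ Ioc 0 ν₁ := ⟨hν.1, hν.2.trans (min_le_left _ _)⟩
  have hνb' : ν ∈ Ioc 0 νb := ⟨hν.1, hν.2.trans (min_le_right _ _)⟩
  have hRHS : 0 ≤ K * ν * ((j : ℝ) + 1) * M ^ (j + 1) := by positivity
  -- the horizon phase
  set JT : ℕ := Jrate (γ ^ 2 - 3) ν + A with hJT
  have hT_eq : DriftFree.horizon (γ ^ 2 - 3) ν A = tStart JT := rfl
  rw [hT_eq] at ht hT
  -- trivial case `t = 0`
  by_cases ht0 : t = 0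
  · subst ht0
    have h0 : Torus.vectorL2Sq (L 0) = 0 := by
      rw [hL0]; simp [Torus.vectorL2Sq]
    rw [h0, Real.sqrt_zero]
    exact hRHS
  have htpos : 0 < t := lt_of_le_of_ne ht.1 (Ne.symm ht0)
  have hJT1 : 1 ≤ JT := by
    by_contra h
    have h0 : JT = 0 := by omega
    have : tStart JT = 0 := by rw [h0]; rfl
    linarith [ht.2]
  -- locate the slot of `t` among the `2 JT` slots before the horizon
  have hK2JT : CascadeParams.tInject (2 * JT / 2) (2 * JT % 2 == 0) = tStart JT := slotStart_even JT
  obtain ⟨k, hk, htk, hk0⟩ := exists_slot ht.1 (by omega : 0 < 2 * JT) (by rw [hK2JT]; exact ht.2)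
  -- the envelope at phase `JT - 1`
  have hJT' : JT - 1 + 1 = JT := by omega
  have hbud' : ∀ j' ≤ JT - 1, 16 * Real.pi ^ 2 * ν * ((P.N j' : ℕ) : ℝ) ^ 2 * tHalf j' ≤ P.δ j' ^ 2 :=
    fun j' hj' => hbud ν hνb' j' (by omega)
  have hJTT : tStart (JT - 1 + 1) ≤ T' := by rw [hJT']; exact hT.le
  have hk' : k < 2 * (JT - 1 + 1) := by rw [hJT']; exact hk
  have hL0' : L 0 = fun _ => 0 := hL0
  have henv := response_envelope_of_budget P (by rw [hP]; exact hδ₀) (by norm_num [hP]) hγ0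
    (fun j => pbox_N_ne_zero γ δ₀ (by omega) j) hν0 (by norm_num : (0 : ℝ) ≤ 3) (hK2ν ν hν₁') hbud' hJTT hT'1
    hL hq hLdiv hL0' hlin hk' htk
  have hC₁0 : 0 ≤ 3 * Real.exp (sawSigmaStar * γ) := by positivity
  have h2 := pbox_sum_le γ hγ0 hδ₀ hρ1 hν0.le hC₁0 k
  have hkj : k / 2 ≤ j := by
    rcases hk0 with h0 | hlt
    · simp [h0]
    · have h1 : tStart (k / 2) < tStart (j + 1) := hlt.trans_le htj.2
      have h2 := tStart_strictMono.lt_iff_lt.1 h1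
      omega
  have hKν : 0 ≤ K * ν := mul_nonneg hK0 hν0.le
  calc Real.sqrt (Torus.vectorL2Sq (L t)) ≤ _ := henv
    _ ≤ (24 * Real.sqrt Real.pi + 6 * Real.sqrt (2 * Real.pi)) * γ / δ₀ * ν * (((k / 2 : ℕ) : ℝ) + 1) *
          (max (3 * Real.exp (sawSigmaStar * γ)) (2 * ρN)) ^ (k / 2 + 1) := h2
    _ = (K * ν) * ((((k / 2 : ℕ) : ℝ) + 1) * M ^ (k / 2 + 1)) := by rw [hK, hM]; ring
    _ ≤ (K * ν) * (((j : ℝ) + 1) * M ^ (j + 1)) := mul_le_mul_of_nonneg_left (envelope_mono hM1 hkj) hKν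
    _ = K * ν * ((j : ℝ) + 1) * M ^ (j + 1) := by ring

/-! ## §4 The envelope with a SYMBOLIC per-phase cap `C` -/

/-- **The geometric `L²` envelope at corner rounding `δ₀` with a symbolic K2-cap `C`**: `responseL2EnvelopeP` with the
constant `3` of `K2PhaseGrowthClassical` replaced by any `C ≥ 0` satisfying the drift-free window `C·e^{σ⋆γ} < γ² − 3`
(at `γ = 8`: every `C ≤ 5`, since `e^{8σ⋆} ≤ 11.925`); then `M₂ = max (C e^{σ⋆γ}) (2ρN) < γ² − 3` and the envelope
`√∫‖L(t)‖² ≤ K ν (j+1) M₂^{j+1}` holds with the same `K = (24√π + 6√(2π)) γ / δ₀`. -/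
theorem responseL2EnvelopePC {γ : ℝ} (hγ : γ ∈ Icc (5 : ℝ) 8) {δ₀ : ℝ} (hδ₀ : 0 < δ₀) {ρN : ℕ}
    (hρN : ρN ∈ Finset.Icc 2 7) {C : ℝ} (hC0 : 0 ≤ C) (hCr : C * Real.exp (sawSigmaStar * γ) < γ ^ 2 - 3)
    (hK2 : K2PhaseGrowthClassical ⟨γ, δ₀, 2, 1, ρN⟩ C) :
    ∃ M₂ K : ℝ, 0 ≤ M₂ ∧ M₂ < γ ^ 2 - 3 ∧ 0 ≤ K ∧
      ∀ A : ℕ, ∃ ν₀ : ℝ, 0 < ν₀ ∧ ∀ ν ∈ Ioc 0 ν₀, ∀ T' : ℝ,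
        DriftFree.horizon (γ ^ 2 - 3) ν A < T' → T' < 1 →
        ∀ (L : ℝ → UnitAddTorus (Fin 2) → EuclideanSpace ℝ (Fin 2)) (q : ℝ → UnitAddTorus (Fin 2) → ℝ),
          Torus.IsSmoothSpaceTimeOn (Icc 0 T') L → Torus.IsSmoothSpaceTimeOn (Icc 0 T') q →
          (∀ t ∈ Icc 0 T', Torus.IsDivFree (L t)) → L 0 = 0 →
          (∀ t ∈ Icc 0 T', ∀ x, Torus.timeDerivWithin (Icc 0 T') L t x +
            Torus.convect ((⟨γ, δ₀, 2, 1, ρN⟩ : CascadeParams).field t) (L t) x +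
            Torus.convect (L t) ((⟨γ, δ₀, 2, 1, ρN⟩ : CascadeParams).field t) x =
              ν • Torus.laplacian (L t) x - Torus.gradient (q t) x +
                ν • Torus.laplacian ((⟨γ, δ₀, 2, 1, ρN⟩ : CascadeParams).field t) x) →
          ∀ j : ℕ, ∀ t ∈ Icc 0 (DriftFree.horizon (γ ^ 2 - 3) ν A),
            t ∈ Icc (CascadeParams.tStart j) (CascadeParams.tStart (j + 1)) →
            Real.sqrt (Torus.vectorL2Sq (L t)) ≤ K * ν * ((j : ℝ) + 1) * M₂ ^ (j + 1) := by
  set P : CascadeParams := ⟨γ, δ₀, 2, 1, ρN⟩ with hP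
  obtain ⟨hρ2, hρ7⟩ := Finset.mem_Icc.1 hρN
  have hρ1 : 1 ≤ ρN := le_trans (by norm_num) hρ2
  have hγ0 : 0 ≤ γ := le_trans (by norm_num) hγ.1
  set M : ℝ := max (C * Real.exp (sawSigmaStar * γ)) (2 * ρN) with hM
  set K : ℝ := (24 * Real.sqrt Real.pi + 6 * Real.sqrt (2 * Real.pi)) * γ / δ₀ with hK
  have hM1 : 1 ≤ M := le_max_of_le_right (by
    have : (2 : ℝ) ≤ ρN := by exact_mod_cast hρ2
    linarith)
  have hM0 : 0 ≤ M := zero_le_one.trans hM1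
  have hMlt : M < γ ^ 2 - 3 := by
    refine max_lt hCr ?_
    have : (ρN : ℝ) ≤ 7 := by exact_mod_cast hρ7
    nlinarith [hγ.1]
  have hK0 : 0 ≤ K := by rw [hK]; positivity
  refine ⟨M, K, hM0, hMlt, hK0, fun A => ?_⟩
  obtain ⟨ν₁, hν₁, hK2ν⟩ := hK2
  obtain ⟨νb, hνb, hbud⟩ := pbudget_threshold hγ hδ₀ hρN A
  refine ⟨min ν₁ νb, lt_min hν₁ hνb, fun ν hν T' hT hT'1 L q hL hq hLdiv hL0 hlin j t ht htj => ?_⟩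
  have hν0 : 0 < ν := hν.1
  have hν₁' : ν ∈ Ioc 0 ν₁ := ⟨hν.1, hν.2.trans (min_le_left _ _)⟩
  have hνb' : ν ∈ Ioc 0 νb := ⟨hν.1, hν.2.trans (min_le_right _ _)⟩
  have hRHS : 0 ≤ K * ν * ((j : ℝ) + 1) * M ^ (j + 1) := by positivity
  set JT : ℕ := Jrate (γ ^ 2 - 3) ν + A with hJT
  have hT_eq : DriftFree.horizon (γ ^ 2 - 3) ν A = tStart JT := rfl
  rw [hT_eq] at ht hT
  by_cases ht0 : t = 0
  · subst ht0
    have h0 : Torus.vectorL2Sq (L 0) = 0 := by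
      rw [hL0]; simp [Torus.vectorL2Sq]
    rw [h0, Real.sqrt_zero]
    exact hRHS
  have htpos : 0 < t := lt_of_le_of_ne ht.1 (Ne.symm ht0)
  have hJT1 : 1 ≤ JT := by
    by_contra h
    have h0 : JT = 0 := by omega
    have : tStart JT = 0 := by rw [h0]; rfl
    linarith [ht.2]
  have hK2JT : CascadeParams.tInject (2 * JT / 2) (2 * JT % 2 == 0) = tStart JT := slotStart_even JT
  obtain ⟨k, hk, htk, hk0⟩ := exists_slot ht.1 (by omega : 0 < 2 * JT) (by rw [hK2JT]; exact ht.2)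
  have hJT' : JT - 1 + 1 = JT := by omega
  have hbud' : ∀ j' ≤ JT - 1, 16 * Real.pi ^ 2 * ν * ((P.N j' : ℕ) : ℝ) ^ 2 * tHalf j' ≤ P.δ j' ^ 2 :=
    fun j' hj' => hbud ν hνb' j' (by omega)
  have hJTT : tStart (JT - 1 + 1) ≤ T' := by rw [hJT']; exact hT.le
  have hk' : k < 2 * (JT - 1 + 1) := by rw [hJT']; exact hk
  have hL0' : L 0 = fun _ => 0 := hL0
  have henv := response_envelope_of_budget P (by rw [hP]; exact hδ₀) (by norm_num [hP]) hγ0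
    (fun j => pbox_N_ne_zero γ δ₀ (by omega) j) hν0 hC0 (hK2ν ν hν₁') hbud' hJTT hT'1
    hL hq hLdiv hL0' hlin hk' htk
  have hC₁0 : 0 ≤ C * Real.exp (sawSigmaStar * γ) := by positivity
  have h2 := pbox_sum_le γ hγ0 hδ₀ hρ1 hν0.le hC₁0 k
  have hkj : k / 2 ≤ j := by
    rcases hk0 with h0 | hlt
    · simp [h0]
    · have h1 : tStart (k / 2) < tStart (j + 1) := hlt.trans_le htj.2
      have h2 := tStart_strictMono.lt_iff_lt.1 h1
      omega
  have hKν : 0 ≤ K * ν := mul_nonneg hK0 hν0.le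
  calc Real.sqrt (Torus.vectorL2Sq (L t)) ≤ _ := henv
    _ ≤ (24 * Real.sqrt Real.pi + 6 * Real.sqrt (2 * Real.pi)) * γ / δ₀ * ν * (((k / 2 : ℕ) : ℝ) + 1) *
          (max (C * Real.exp (sawSigmaStar * γ)) (2 * ρN)) ^ (k / 2 + 1) := h2
    _ = (K * ν) * ((((k / 2 : ℕ) : ℝ) + 1) * M ^ (k / 2 + 1)) := by rw [hK, hM]; ring
    _ ≤ (K * ν) * (((j : ℝ) + 1) * M ^ (j + 1)) := mul_le_mul_of_nonneg_left (envelope_mono hM1 hkj) hKν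
    _ = K * ν * ((j : ℝ) + 1) * M ^ (j + 1) := by ring

end Summit.AnomalousDissipation.AnomalousDissipation.Theorems.SawtoothPulseCascade.ApproxResponse

end
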